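import Summits.CriticalPhenomena.CardyFormulaZ2.Theorems.CardyBoundaryCoulombGasStripClusterRatesTwoClusterCardyOrderLiminf
import Summits.CriticalPhenomena.CardyFormulaZ2.Theorems.CardyBoundaryCoulombGasStripClusterRatesQuasiMultRate
import Summits.CriticalPhenomena.CardyFormulaZ2.Theorems.CardyBoundaryCoulombGasStripClusterRatesQuasiMultLimit

/-!
# TM order ⟺ Cardy order for the two-cluster Kac constant, MODULO two-cluster quasi-multiplicativity

Support file for line `two-cluster-rate-is-stationary-gap` (crux `StripClusterRates`,
stmt-CriticalPhenomena-13878), lead c5; companion of `…TwoClusterCardyOrderLiminf` (the free half). The γ₂-half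
of the crux (= K₂) is a statement in TRANSFER-MATRIX ORDER: `n·γ₂(n) → 2π` with `γ₂(n) = lim_m −log p₂(m,n)/m`.
Cardy's prediction is printed in CARDY ORDER: `−log lim_n p₂(A·n, n) = g(A)` with `g(A)/A → 2π`. This file
isolates the ONE lattice statement under which the two orders agree for two clusters — QUASI-MULTIPLICATIVITY of
`p₂` in the length with a width-proportional gap and a width-uniform constant,

  `QM₂ :  ∃ C > 0, ∃ k, ∀ n ≥ 1, ∀ m₁ m₂,  p₂(m₁,n) · p₂(m₂,n) ≤ C · p₂(m₁ + m₂ + k·n, n)`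

(an RSW-level gluing statement for open–closed–open strip structures; NOT in the tree; taken here as a
HYPOTHESIS, inlined — no definition is introduced):

* §1 `qm_rateTwo_le_finite : QM₂ ⇒ γ₂(n) ≤ (−log p₂(m,n) + log C)/(m + k·n)` for every `m ≥ 1` (Fekete with a gap,
  registered sub-goal `qm_rate_le_finite`), the mirror image of `rateTwo_ge_finite : γ₂(n) ≥ −log p₂(m,n)/(m+1)`
  (sub-multiplicativity, landed);
* §2 `nMul_rateTwo_limit_le_of_quasiMult : QM₂ ⇒` (Cardy-order convergence `−log p₂(A·n,n) → g(A)`, `g(A)/A → c`)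
  `⇒ L₂ ≤ c` for every limit `L₂` of `n·γ₂(n)` (registered sub-goal `qm_limit_le_of_finite_bounds`); with the landed
  liminf half, `nMul_rateTwo_limit_eq_of_quasiMult : L₂ = c`;
* §3 `tendsto_nMul_rateTwo_of_quasiMult`: under QM₂ and Cardy-order two-cluster Kac with constant `c`, the FULL sequence
  converges, `n·γ₂(n) → c`, for every family of two-cluster rates — i.e. with `c = 2π` exactly the γ₂-conjunct of the
  crux (`kacTwoHalf_of_quasiMult_of_cardyOrderKac`, registered). So: K₂ ⟸ QM₂ ∧ (Cardy-order `h_{1,5} = 2`), and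
  conversely K₂ ⇒ the Cardy-order constant is `2π` whenever the Cardy-order limits exist (§2 read backwards).

QM₂ is the natural provable γ₂-side ITEM (arm separation in the strip); the Cardy-order statement is the SLE₆
prediction (Cardy 1998 (bb); for site percolation on 𝕋 it would follow from Smirnov–Werner-type three-arm
half-plane exponents).

References: [Cardy1998] eq. (bb); [Aizenman1997] Thm 3 (quasi-multiplicativity is implicit in the `n²` window);
M. Fekete (1923); Kesten, *Scaling relations* (1987) for arm separation.
-/

noncomputable section

open MeasureTheory Filter Topology
open Literature.Probability.LatticeModels Literature.Probability.Percolation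

namespace Summit.CriticalPhenomena.CardyFormulaZ2.Cruxes.StripClusterRates.TwoClusterRateIsStationaryGap

open Summit.CriticalPhenomena.CardyFormulaZ2.Theorems.StripClusterRates.Negative

/-! ## §1 Finite-length UPPER bounds on the two-cluster rate from quasi-multiplicativity -/

/-- **Fekete with a gap**: under QM₂ (constant `C`, gap `k·n`), for `n ≥ 1` every limit `γ` of `−log p₂(m',n)/m'`
satisfies `γ ≤ (−log p₂(m,n) + log C)/(m + k·n)` for EVERY `m ≥ 1`. [folklore] -/
theorem qm_rateTwo_le_finite {C : ℝ} {k : ℕ} (hC : 0 < C)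
    (hqm : ∀ n : ℕ, 1 ≤ n → ∀ m₁ m₂ : ℕ, pTwo m₁ n * pTwo m₂ n ≤ C * pTwo (m₁ + m₂ + k * n) n)
    {n : ℕ} (hn : 1 ≤ n) {γ : ℝ} (h : Tendsto (rateSeqTwo n) atTop (𝓝 γ)) {m : ℕ} (hm : 1 ≤ m) :
    γ ≤ (-Real.log (pTwo m n) + Real.log C) / ((m : ℝ) + k * n) := by
  have := qm_rate_le_finite (fun m ↦ pTwo m n) C (k * n) hC (fun m ↦ co_pTwo_pos hn m) (hqm n hn) γ h m hm
  simpa only [Nat.cast_mul] using this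

/-! ## §2 The limsup half of the order transfer, modulo QM₂ -/

/-- **Cardy order bounds TM order from ABOVE, modulo QM₂**: if `p₂` is quasi-multiplicative in the length
(QM₂), `−log p₂(A·n, n) → g(A)` for every integer aspect ratio `A ≥ 1` and `g(A)/A → c`, then every limit `L₂`
of `n·γ₂(n)` satisfies `L₂ ≤ c`. [cite: Cardy1998, eq. (bb)] -/
theorem nMul_rateTwo_limit_le_of_quasiMult {γ₂ : ℕ → ℝ}
    (h₂ : ∀ n : ℕ, 1 ≤ n → Tendsto (rateSeqTwo n) atTop (𝓝 (γ₂ n)))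
    (hQM : ∃ C : ℝ, 0 < C ∧ ∃ k : ℕ, ∀ n : ℕ, 1 ≤ n → ∀ m₁ m₂ : ℕ,
      pTwo m₁ n * pTwo m₂ n ≤ C * pTwo (m₁ + m₂ + k * n) n)
    {g : ℕ → ℝ} (hg : ∀ A : ℕ, 1 ≤ A → Tendsto (fun n : ℕ ↦ -Real.log (pTwo (A * n) n)) atTop (𝓝 (g A)))
    {c : ℝ} (hc : Tendsto (fun A : ℕ ↦ g A / A) atTop (𝓝 c))
    {L₂ : ℝ} (hL : Tendsto (fun n : ℕ ↦ (n : ℝ) * γ₂ n) atTop (𝓝 L₂)) : L₂ ≤ c := by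
  obtain ⟨C, hC, k, hqm⟩ := hQM
  exact qm_limit_le_of_finite_bounds γ₂ pTwo C k g c L₂
    (fun n hn m hm ↦ qm_rateTwo_le_finite hC hqm hn (h₂ n hn) hm) hg hc hL

/-- **The order transfer modulo QM₂**: under QM₂ and Cardy-order convergence with `g(A)/A → c`, every limit of
`n·γ₂(n)` EQUALS `c` (liminf half: `nMul_rateTwo_limit_ge_of_cardyOrderKac`, landed, unconditional in QM₂). [cite: Cardy1998, eq. (bb)] -/
theorem nMul_rateTwo_limit_eq_of_quasiMult {γ₂ : ℕ → ℝ}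
    (h₂ : ∀ n : ℕ, 1 ≤ n → Tendsto (rateSeqTwo n) atTop (𝓝 (γ₂ n)))
    (hQM : ∃ C : ℝ, 0 < C ∧ ∃ k : ℕ, ∀ n : ℕ, 1 ≤ n → ∀ m₁ m₂ : ℕ,
      pTwo m₁ n * pTwo m₂ n ≤ C * pTwo (m₁ + m₂ + k * n) n)
    {g : ℕ → ℝ} (hg : ∀ A : ℕ, 1 ≤ A → Tendsto (fun n : ℕ ↦ -Real.log (pTwo (A * n) n)) atTop (𝓝 (g A)))
    {c : ℝ} (hc : Tendsto (fun A : ℕ ↦ g A / A) atTop (𝓝 c))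
    {L₂ : ℝ} (hL : Tendsto (fun n : ℕ ↦ (n : ℝ) * γ₂ n) atTop (𝓝 L₂)) : L₂ = c :=
  le_antisymm (nMul_rateTwo_limit_le_of_quasiMult h₂ hQM hg hc hL) (nMul_rateTwo_limit_ge_of_cardyOrderKac h₂ hg hc hL)

/-! ## §3 Convergence of the full sequence `n·γ₂(n)` modulo QM₂ -/

/-- `(g(A) + log C)/(A + k) → c` when `g(A)/A → c`. [folklore] -/
theorem qm_tendsto_shifted_ratio {g : ℕ → ℝ} {c : ℝ} (hc : Tendsto (fun A : ℕ ↦ g A / A) atTop (𝓝 c))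
    (C : ℝ) (k : ℕ) : Tendsto (fun A : ℕ ↦ (g A + Real.log C) / ((A : ℝ) + k)) atTop (𝓝 c) := by
  -- (g A + log C)/(A + k) = (g A / A + log C / A) * (A / (A + k)) for A ≥ 1
  have h1 : Tendsto (fun A : ℕ ↦ Real.log C / (A : ℝ)) atTop (𝓝 0) :=
    tendsto_const_nhds.div_atTop tendsto_natCast_atTop_atTop
  have h2 : Tendsto (fun A : ℕ ↦ (A : ℝ) / ((A : ℝ) + k)) atTop (𝓝 1) := by
    have h : Tendsto (fun A : ℕ ↦ 1 / (1 + (k : ℝ) / (A : ℝ))) atTop (𝓝 (1 / (1 + 0))) := by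
      refine tendsto_const_nhds.div (tendsto_const_nhds.add ?_) (by norm_num)
      exact tendsto_const_nhds.div_atTop tendsto_natCast_atTop_atTop
    rw [add_zero, div_one] at h
    refine h.congr' ?_
    filter_upwards [eventually_ge_atTop 1] with A hA
    have hA' : (0 : ℝ) < A := by exact_mod_cast hA
    field_simp
  have h3 : Tendsto (fun A : ℕ ↦ (g A / A + Real.log C / (A : ℝ)) * ((A : ℝ) / ((A : ℝ) + k))) atTop
      (𝓝 ((c + 0) * 1)) := (hc.add h1).mul h2
  rw [add_zero, mul_one] at h3
  refine h3.congr' ?_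
  filter_upwards [eventually_ge_atTop 1] with A hA
  have hA' : (0 : ℝ) < A := by exact_mod_cast hA
  have hAk : (0 : ℝ) < (A : ℝ) + k := by positivity
  field_simp

/-- **Convergence of `n·γ₂(n)` modulo QM₂.** Under QM₂ and Cardy-order convergence `−log p₂(A·n,n) → g(A)` (all
integer `A ≥ 1`) with `g(A)/A → c`, the full sequence converges: `n·γ₂(n) → c`, for EVERY family of two-cluster
rates `γ₂` — squeezed between `n·(−log p₂(An,n))/(An+1) → g(A)/A` (sub-multiplicativity) and
`(−log p₂(An,n) + log C)/(A+k) → (g(A)+log C)/(A+k)` (QM₂), both `→ c` as `A → ∞`. [cite: Cardy1998, eq. (bb)] -/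
theorem tendsto_nMul_rateTwo_of_quasiMult {γ₂ : ℕ → ℝ}
    (h₂ : ∀ n : ℕ, 1 ≤ n → Tendsto (rateSeqTwo n) atTop (𝓝 (γ₂ n)))
    (hQM : ∃ C : ℝ, 0 < C ∧ ∃ k : ℕ, ∀ n : ℕ, 1 ≤ n → ∀ m₁ m₂ : ℕ,
      pTwo m₁ n * pTwo m₂ n ≤ C * pTwo (m₁ + m₂ + k * n) n)
    {g : ℕ → ℝ} (hg : ∀ A : ℕ, 1 ≤ A → Tendsto (fun n : ℕ ↦ -Real.log (pTwo (A * n) n)) atTop (𝓝 (g A)))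
    {c : ℝ} (hc : Tendsto (fun A : ℕ ↦ g A / A) atTop (𝓝 c)) :
    Tendsto (fun n : ℕ ↦ (n : ℝ) * γ₂ n) atTop (𝓝 c) := by
  obtain ⟨C, hC, k, hqm⟩ := hQM
  rw [tendsto_order]
  constructor
  · -- lower: from sub-multiplicativity at a good aspect ratio
    intro a ha
    obtain ⟨A, hA1, hA⟩ : ∃ A : ℕ, 1 ≤ A ∧ a < g A / A := by
      have hev : ∀ᶠ A : ℕ in atTop, a < g A / A := (tendsto_order.1 hc).1 a ha
      obtain ⟨A, hA⟩ := (hev.and (eventually_ge_atTop 1)).exists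
      exact ⟨A, hA.2, hA.1⟩
    have hcmp : Tendsto (fun n : ℕ ↦ -Real.log (pTwo (A * n) n) * ((n : ℝ) / ((A : ℝ) * n + 1))) atTop
        (𝓝 (g A * (1 / (A : ℝ)))) := (hg A hA1).mul (co_tendsto_div_aspect hA1)
    rw [mul_one_div] at hcmp
    have hev := (tendsto_order.1 hcmp).1 a hA
    filter_upwards [hev, eventually_ge_atTop 1] with n hn hn1
    refine lt_of_lt_of_le hn ?_
    have h := nMul_rateTwo_ge_finite hn1 (h₂ n hn1) (A * n)
    have hden : ((A * n : ℕ) : ℝ) + 1 = (A : ℝ) * n + 1 := by push_cast; ring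
    rw [hden] at h
    calc -Real.log (pTwo (A * n) n) * ((n : ℝ) / ((A : ℝ) * n + 1))
        = (n : ℝ) * (-Real.log (pTwo (A * n) n) / ((A : ℝ) * n + 1)) := by ring
      _ ≤ (n : ℝ) * γ₂ n := h
  · -- upper: from quasi-multiplicativity at a good aspect ratio
    intro b hb
    have hratio := qm_tendsto_shifted_ratio hc C k
    obtain ⟨A, hA1, hA⟩ : ∃ A : ℕ, 1 ≤ A ∧ (g A + Real.log C) / ((A : ℝ) + k) < b := by
      have hev : ∀ᶠ A : ℕ in atTop, (g A + Real.log C) / ((A : ℝ) + k) < b := (tendsto_order.1 hratio).2 b hb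
      obtain ⟨A, hA⟩ := (hev.and (eventually_ge_atTop 1)).exists
      exact ⟨A, hA.2, hA.1⟩
    have hcmp : Tendsto (fun n : ℕ ↦ (-Real.log (pTwo (A * n) n) + Real.log C) / ((A : ℝ) + k)) atTop
        (𝓝 ((g A + Real.log C) / ((A : ℝ) + k))) := ((hg A hA1).add_const _).div_const _
    have hev := (tendsto_order.1 hcmp).2 b hA
    filter_upwards [hev, eventually_ge_atTop 1] with n hn hn1
    refine lt_of_le_of_lt ?_ hn
    have h := qm_rateTwo_le_finite hC hqm hn1 (h₂ n hn1) (m := A * n) (Nat.mul_pos hA1 hn1)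
    have hn0 : (0 : ℝ) < n := by exact_mod_cast hn1
    have hAk : (0 : ℝ) < (A : ℝ) + k := by positivity
    have hden : ((A * n : ℕ) : ℝ) + k * n = (n : ℝ) * ((A : ℝ) + k) := by push_cast; ring
    rw [hden] at h
    calc (n : ℝ) * γ₂ n ≤ (n : ℝ) * ((-Real.log (pTwo (A * n) n) + Real.log C) / ((n : ℝ) * ((A : ℝ) + k))) :=
          mul_le_mul_of_nonneg_left h hn0.le
      _ = (-Real.log (pTwo (A * n) n) + Real.log C) / ((A : ℝ) + k) := by
          field_simp

/-- **K₂'s γ₂-conjunct from QM₂ and Cardy-order two-cluster Kac** (registered sub-goal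
`kacTwoHalf_of_quasiMult_of_cardyOrderKac`; the two-cluster event inlined): if `p₂` is quasi-multiplicative
in the length (QM₂) and `−log p₂(A·n, n) → g(A)` with `g(A)/A → 2π` (Cardy 1998 (bb), `n = 2`, Cardy order),
then `n·γ₂(n) → 2π` for every family of two-cluster rates — the γ₂-half of `StripClusterRates` (hence, with the
conjunct, the crux: `stripClusterRates_of_cardyFormulaZ2_of_kacTwo` + `twoClusterKac_iff_kacTwo`). [cite: Cardy1998, eq. (bb)] -/
theorem kacTwoHalf_of_quasiMult_of_cardyOrderKac : (∃ C : ℝ, 0 < C ∧ ∃ k : ℕ, ∀ n : ℕ, 1 ≤ n → ∀ m₁ m₂ : ℕ, (bondPercolation (zdGraph 2) half).real {ω | ∃ x₁ ∈ (leftSide m₁ n : Set (Site 2)), ∃ y₁ ∈ (rightSide m₁ n : Set (Site 2)), ∃ x₂ ∈ (leftSide m₁ n : Set (Site 2)), ∃ y₂ ∈ (rightSide m₁ n : Set (Site 2)), ω ∈ openConnIn (rectangle m₁ n : Set (Site 2)) x₁ y₁ ∧ ω ∈ openConnIn (rectangle m₁ n : Set (Site 2)) x₂ y₂ ∧ ω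 ∉ openConnIn (rectangle m₁ n : Set (Site 2)) x₁ x₂} * (bondPercolation (zdGraph 2) half).real {ω | ∃ x₁ ∈ (leftSide m₂ n : Set (Site 2)), ∃ y₁ ∈ (rightSide m₂ n : Set (Site 2)), ∃ x₂ ∈ (leftSide m₂ n : Set (Site 2)), ∃ y₂ ∈ (rightSide m₂ n : Set (Site 2)), ω ∈ openConnIn (rectangle m₂ n : Set (Site 2)) x₁ y₁ ∧ ω ∈ openConnIn (rectangle m₂ n : Set (Site 2)) x₂ y₂ ∧ ω ∉ openConnIn (rectangle m₂ n : Set (Site 2)) x₁ x₂} ≤ C * (bondPercolation (zdGraph 2) half).real {ω | ∃ x₁ ∈ (leftSide (m₁ + m₂ + k * n) n : Set (Site 2)), ∃ y₁ ∈ (rightSide (m₁ + m₂ + k * n) n : Set (Site 2)), ∃ x₂ ∈ (leftSide (m₁ + m₂ + k * n) n : Set (Site 2)), ∃ y₂ ∈ (rightSide (m₁ + m₂ + k * n) n : Set (Site 2)), ω ∈ openConnIn (rectangle (m₁ + m₂ + k * n) n : Set (Site 2)) x₁ y₁ ∧ ω ∈ openConnIn (rectangle (m₁ + m₂ + k * n)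 n : Set (Site 2)) x₂ y₂ ∧ ω ∉ openConnIn (rectangle (m₁ + m₂ + k * n) n : Set (Site 2)) x₁ x₂}) → ∀ g : ℕ → ℝ, (∀ A : ℕ, 1 ≤ A → Tendsto (fun n : ℕ ↦ -Real.log ((bondPercolation (zdGraph 2) half).real {ω | ∃ x₁ ∈ (leftSide (A * n) n : Set (Site 2)), ∃ y₁ ∈ (rightSide (A * n) n : Set (Site 2)), ∃ x₂ ∈ (leftSide (A * n) n : Set (Site 2)), ∃ y₂ ∈ (rightSide (A * n) n : Set (Site 2)), ω ∈ openConnIn (rectangle (A * n) n : Set (Site 2)) x₁ y₁ ∧ ω ∈ openConnIn (rectangle (A * n) n : Set (Site 2)) x₂ y₂ ∧ ω ∉ openConnIn (rectangle (A * n) n : Set (Site 2)) x₁ x₂})) atTop (𝓝 (g A))) → Tendsto (fun A : ℕ ↦ g A / A) atTop (𝓝 (2 * Real.pi)) → ∀ γ₂ : ℕ → ℝ, (∀ n : ℕ, 1 ≤ n → Tendsto (fun m : ℕ ↦ -Real.log ((bondPercolation (zdGraph 2) half).real {ω | ∃ x₁ ∈ (leftSide m n : Set (Site 2)), ∃ y₁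 ∈ (rightSide m n : Set (Site 2)), ∃ x₂ ∈ (leftSide m n : Set (Site 2)), ∃ y₂ ∈ (rightSide m n : Set (Site 2)), ω ∈ openConnIn (rectangle m n : Set (Site 2)) x₁ y₁ ∧ ω ∈ openConnIn (rectangle m n : Set (Site 2)) x₂ y₂ ∧ ω ∉ openConnIn (rectangle m n : Set (Site 2)) x₁ x₂}) / (m : ℝ)) atTop (𝓝 (γ₂ n))) → Tendsto (fun n : ℕ ↦ (n : ℝ) * γ₂ n) atTop (𝓝 (2 * Real.pi)) :=
  fun hQM _ hg hc _ h₂ => tendsto_nMul_rateTwo_of_quasiMult h₂ hQM hg hc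

end Summit.CriticalPhenomena.CardyFormulaZ2.Cruxes.StripClusterRates.TwoClusterRateIsStationaryGap

end
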